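import Summits.ABC.ABC.Theorems.TowerFourSubLiouville.Negative.TwoExponentDiagram

/-!
# `TowerFourSubLiouville` (stmt-ABC-1649): the dial of the typed strengthening `PolySzpiro s` (S⁺4) — floor `6`

Negative-side module of the standing disprover (cycle 12, refuter-cdisprove-stmt-ABC-1649-g12-0, 2026-08-17), companion of
`Negative.HallLangTransferPell` (p132424: the S⁺1 dial `HallLang1728 κ` pinned at `κ = 2`) and `Negative.TwoExponentSandwich`
(p137739: the moving-target rungs S⁺2/S⁺3 sandwiched).

The round-2 ideator 4 (`Cruxes/TowerFourSubLiouville/SketchIdeator4.lean`) typed **polynomial Szpiro in abc-coordinates**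

  `PolySzpiro s := ∃ C > 0, ∀ abc triples (a, b, c), (abc)² ≤ C · rad(abc)^s`

(`Δ_Frey = 16(abc)²`, `N_Frey ∣ 2⁸ rad(abc)`; `s = 6 + ε` for every `ε > 0` is Szpiro's conjecture) together with the edge
`SzpiroEdge : ∀ s < 8, PolySzpiro s → TowerFourSubLiouville` (unlanded; `abc ≥ c²/2`, `rad ∣ Π`), and the strategist's census lists
it as S⁺4 ("stronger than polynomial abc with exponent `s/4 < 2`; engines exponential").  The ideator's docstring says "every `s` is
open".  That is not right for `s < 6`, and this file records the dial (matrix of `PolySzpiro` VERBATIM, spelled out in each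
statement — `Cruxes/` files are not importable and a Negative/ module adds no definitions):

* `not_polySzpiro_of_lt_six`: **`PolySzpiro s` is FALSE for every `s < 6`** — elementary, by the power family
  `m^{k+1} + b = (m+1)^{k+1}` (`powerFamily_isABCTriple`): `rad(abc) ≤ m · b · (m+1) ≤ (m+1)^{k+3}` while
  `(abc)² ≥ (m+1)^{6k+4} / 4^{k+1}`, so `(abc)² ≤ C rad^s` forces `(m+1)^{6k+4−(k+3)s} ≤ 4^{k+1} C`, impossible for
  `k > (3s − 4)/(6 − s)` and `m → ∞`.  (This is the abc-coordinate form of "Szpiro's exponent `6` cannot be lowered": the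
  family is the Mason–Stothers-tight identity `X^{k+1} + (Y^{k+1} − X^{k+1}) = Y^{k+1}` of unbounded degree, whose radical
  degree `k + 3` against `3(k+1)` for `abc` gives the limiting ratio `6`.)
* `polySzpiro_mono`: the dial is monotone (`rad ≥ 1`).
* `polySzpiro_of_abc`: **`ABC ⟹ PolySzpiro s` for every `s > 6`** (`(abc)² ≤ c⁶ < C⁶ rad^{6(1+ε)}`, `ε = s/6 − 1`).
* The boundary point `s = 6` (Szpiro's conjecture WITHOUT `ε`, in abc-coordinates) is false in print — D. W. Masser, *Note on a
  conjecture of Szpiro*, Astérisque 183 (1990) 19–23 (Zbl 0742.14027): no absolute `C, k` with `|D| ≤ C N⁶ (log N)^k` — by a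
  Stewart–Tijdeman-type pigeonhole construction; it is NOT formalised here (it needs prime-counting input), so in the tree the
  status of `s = 6` is "open, refuted in print".

So the S⁺4 dial reads: FALSE for `s < 6` (here, unconditional) and at `s = 6` (Masser 1990); `ABC`-TRUE for `s > 6` (here); the
edge needs `s < 8`.  `SzpiroEdge` therefore has content exactly on `s ∈ (6, 8)`, where `PolySzpiro s` sits between Szpiro's
conjecture and polynomial abc with exponent `s/4 ∈ (3/2, 2)` — like every other typed strengthening of this crux (`HallLang1728`,
`UniformLjunggren`, Lang–Waldschmidt₄, the moving-target rungs) it is `ABC`-implied and unrefutable short of `¬ABC` in its useful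
range, and refuted below it by an explicit identity family.  Calibration, not a kill.
-/

-- `Summit.ABC.ABC` is the mandated summit-side namespace (CONVENTIONS §2); the duplicate is deliberate.
set_option linter.dupNamespace false

namespace Summit.ABC.ABC.Theorems.TowerFourSubLiouville.Negative

open Literature.NumberTheory.DiophantineGeometry (IsABCTriple rad rad_def)
open UniqueFactorizationMonoid (radical radical_mul_dvd radical_pow_dvd radical_dvd_self radical_ne_zero)

/-! Throughout, `PolySzpiro s` denotes the matrix (verbatim from `Cruxes/TowerFourSubLiouville/SketchIdeator4.lean`,
`Ideator4.PolySzpiro`, the hypothesis of the typed edge `SzpiroEdge`; spelled out in every statement so that this file adds no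
definition):  `∃ C : ℝ, 0 < C ∧ ∀ a b c : ℕ, IsABCTriple a b c → ((a * b * c : ℕ) : ℝ) ^ 2 ≤ C * (rad a b c : ℝ) ^ s`. -/

/-- `rad ≥ 1` always (radicals in `ℕ` are nonzero). -/
theorem one_le_rad (a b c : ℕ) : 1 ≤ rad a b c := by
  rw [rad_def]
  exact Nat.one_le_iff_ne_zero.mpr radical_ne_zero

/-- The dial is monotone: a bound with exponent `s` is a bound with any larger exponent. -/
theorem polySzpiro_mono {s t : ℝ} (hst : s ≤ t)
    (h : ∃ C : ℝ, 0 < C ∧ ∀ a b c : ℕ, IsABCTriple a b c →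
      (((a * b * c : ℕ) : ℝ)) ^ (2 : ℕ) ≤ C * ((rad a b c : ℕ) : ℝ) ^ s) :
    ∃ C : ℝ, 0 < C ∧ ∀ a b c : ℕ, IsABCTriple a b c →
      (((a * b * c : ℕ) : ℝ)) ^ (2 : ℕ) ≤ C * ((rad a b c : ℕ) : ℝ) ^ t := by
  obtain ⟨C, hC, h⟩ := h
  refine ⟨C, hC, fun a b c habc => (h a b c habc).trans ?_⟩
  apply mul_le_mul_of_nonneg_left _ hC.le
  have h1 : (1 : ℝ) ≤ ((rad a b c : ℕ) : ℝ) := by exact_mod_cast one_le_rad a b c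
  exact Real.rpow_le_rpow_of_exponent_le h1 hst

/-! ## The power family `m^{k+1} + b = (m+1)^{k+1}` -/

/-- The power family is an abc triple for every `m ≥ 1` and every `k`. -/
theorem powerFamily_isABCTriple (m k : ℕ) (hm : 1 ≤ m) :
    IsABCTriple (m ^ (k + 1)) ((m + 1) ^ (k + 1) - m ^ (k + 1)) ((m + 1) ^ (k + 1)) := by
  have hlt : m ^ (k + 1) < (m + 1) ^ (k + 1) :=
    Nat.pow_lt_pow_left (Nat.lt_succ_self m) (Nat.succ_ne_zero k)
  refine ⟨pow_pos hm _, Nat.sub_pos_of_lt hlt, Nat.add_sub_of_le hlt.le, ?_⟩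
  rw [Nat.coprime_sub_self_right hlt.le]
  exact (Nat.coprime_self_add_right.mpr (Nat.coprime_one_right m)).pow _ _

/-- The middle term is at least `(m+1)^k`:  `(m+1)^{k+1} − m^{k+1} ≥ (m+1)^k`. -/
theorem powerFamily_b_ge (m k : ℕ) : (m + 1) ^ k ≤ (m + 1) ^ (k + 1) - m ^ (k + 1) := by
  apply Nat.le_sub_of_add_le
  have h : m ^ k ≤ (m + 1) ^ k := Nat.pow_le_pow_left (Nat.le_succ m) k
  calc (m + 1) ^ k + m ^ (k + 1) = (m + 1) ^ k + m * m ^ k := by ring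
    _ ≤ (m + 1) ^ k + m * (m + 1) ^ k := by gcongr
    _ = (m + 1) ^ (k + 1) := by ring

/-- The radical of the power family divides `m · b · (m+1)`. -/
theorem rad_powerFamily_le (m k : ℕ) (hm : 1 ≤ m) :
    rad (m ^ (k + 1)) ((m + 1) ^ (k + 1) - m ^ (k + 1)) ((m + 1) ^ (k + 1)) ≤
      m * ((m + 1) ^ (k + 1) - m ^ (k + 1)) * (m + 1) := by
  have hbpos : 0 < (m + 1) ^ (k + 1) - m ^ (k + 1) := (powerFamily_isABCTriple m k hm).2.1
  rw [rad_def]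
  apply Nat.le_of_dvd (by positivity)
  calc radical (m ^ (k + 1) * ((m + 1) ^ (k + 1) - m ^ (k + 1)) * (m + 1) ^ (k + 1))
      ∣ radical (m ^ (k + 1) * ((m + 1) ^ (k + 1) - m ^ (k + 1))) * radical ((m + 1) ^ (k + 1)) :=
        radical_mul_dvd
    _ ∣ (radical (m ^ (k + 1)) * radical ((m + 1) ^ (k + 1) - m ^ (k + 1))) * radical ((m + 1) ^ (k + 1)) :=
        mul_dvd_mul_right radical_mul_dvd _
    _ ∣ (m * ((m + 1) ^ (k + 1) - m ^ (k + 1))) * (m + 1) :=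
        mul_dvd_mul (mul_dvd_mul (radical_pow_dvd.trans radical_dvd_self) radical_dvd_self)
          (radical_pow_dvd.trans radical_dvd_self)

/-! ## The floor: `PolySzpiro s` is false for every `s < 6` -/

/-- **`PolySzpiro s` fails for every `s < 6`.**  Push the dial up to `t = max s 5 ∈ [5, 6)`, pick the degree `k` with
`(k + 3) t < 6k + 4`, and run the power family: `(abc)² ≥ (m+1)^{6k+4}/4^{k+1}` against `C rad^t ≤ C (m+1)^{(k+3)t}`. -/
theorem not_polySzpiro_of_lt_six {s : ℝ} (hs : s < 6) :
    ¬ ∃ C : ℝ, 0 < C ∧ ∀ a b c : ℕ, IsABCTriple a b c →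
      (((a * b * c : ℕ) : ℝ)) ^ (2 : ℕ) ≤ C * ((rad a b c : ℕ) : ℝ) ^ s := by
  intro h
  -- the dial pushed up to `t ∈ [5, 6)`
  set t : ℝ := max s 5 with ht
  have ht5 : 5 ≤ t := le_max_right _ _
  have ht6 : t < 6 := max_lt hs (by norm_num)
  obtain ⟨C, hC, hh⟩ := polySzpiro_mono (le_max_left s 5) h
  -- the degree `k`
  obtain ⟨k, hk⟩ := exists_nat_gt ((3 * t - 4) / (6 - t))
  have hE : ((k : ℝ) + 3) * t < 6 * k + 4 := by
    have h6 : 0 < 6 - t := by linarith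
    have h1 : 3 * t - 4 < k * (6 - t) := (div_lt_iff₀ h6).mp hk
    nlinarith
  -- growth: eventually `(C K + 1) n^{(k+3)t} ≤ n^{6k+4}` with `K = (2^{k+1})²`
  set K : ℝ := ((2 : ℝ) ^ (k + 1)) ^ 2 with hK
  have hK0 : 0 < K := by positivity
  obtain ⟨N, hN⟩ := eventually_const_mul_rpow_le (C * K + 1) (((k : ℝ) + 3) * t) (6 * k + 4) hE
  -- the member `m = max N 1`, `n = m + 1`
  set m : ℕ := max N 1 with hm
  have hm1 : 1 ≤ m := le_max_right _ _
  have hNm : N ≤ m + 1 := le_trans (le_max_left _ _) (Nat.le_succ m)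
  have habc := powerFamily_isABCTriple m k hm1
  have hbge := powerFamily_b_ge m k
  have hble : (m + 1) ^ (k + 1) - m ^ (k + 1) ≤ (m + 1) ^ (k + 1) := Nat.sub_le _ _
  have hrad := rad_powerFamily_le m k hm1
  have key := hh _ _ _ habc
  generalize hbdef : (m + 1) ^ (k + 1) - m ^ (k + 1) = b at habc hbge hble hrad key
  -- real bookkeeping
  set nR : ℝ := (m : ℝ) + 1 with hnR
  have hn0 : (0 : ℝ) < nR := by positivity
  have hcast : ((m + 1 : ℕ) : ℝ) = nR := by push_cast; rfl
  have hmR : nR ≤ 2 * (m : ℝ) := by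
    have : (1 : ℝ) ≤ m := by exact_mod_cast hm1
    rw [hnR]; linarith
  -- lower bound for `abc`
  have hbR : nR ^ k ≤ (b : ℝ) := by
    have : (((m + 1) ^ k : ℕ) : ℝ) ≤ (b : ℝ) := by exact_mod_cast hbge
    push_cast at this
    exact this
  have h2m : nR ^ (k + 1) ≤ (2 : ℝ) ^ (k + 1) * (m : ℝ) ^ (k + 1) := by
    rw [← mul_pow]; exact pow_le_pow_left₀ hn0.le hmR _
  have habcR : nR ^ (3 * k + 2) ≤ (2 : ℝ) ^ (k + 1) * (((m ^ (k + 1) * b * (m + 1) ^ (k + 1) : ℕ) : ℝ)) := by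
    push_cast
    calc nR ^ (3 * k + 2) = nR ^ (k + 1) * nR ^ k * nR ^ (k + 1) := by ring
      _ ≤ ((2 : ℝ) ^ (k + 1) * (m : ℝ) ^ (k + 1)) * (b : ℝ) * nR ^ (k + 1) := by gcongr
      _ = (2 : ℝ) ^ (k + 1) * ((m : ℝ) ^ (k + 1) * (b : ℝ) * ((m : ℝ) + 1) ^ (k + 1)) := by rw [hnR]; ring
  have hsq : nR ^ (6 * k + 4) ≤ K * (((m ^ (k + 1) * b * (m + 1) ^ (k + 1) : ℕ) : ℝ)) ^ (2 : ℕ) := by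
    have := pow_le_pow_left₀ (by positivity) habcR 2
    calc nR ^ (6 * k + 4) = (nR ^ (3 * k + 2)) ^ 2 := by ring
      _ ≤ ((2 : ℝ) ^ (k + 1) * (((m ^ (k + 1) * b * (m + 1) ^ (k + 1) : ℕ) : ℝ))) ^ 2 := this
      _ = K * (((m ^ (k + 1) * b * (m + 1) ^ (k + 1) : ℕ) : ℝ)) ^ (2 : ℕ) := by rw [hK]; ring
  -- upper bound for `rad`
  have hradN : rad (m ^ (k + 1)) b ((m + 1) ^ (k + 1)) ≤ (m + 1) ^ (k + 3) := by
    calc rad (m ^ (k + 1)) b ((m + 1) ^ (k + 1)) ≤ m * b * (m + 1) := hrad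
      _ ≤ (m + 1) * (m + 1) ^ (k + 1) * (m + 1) := by gcongr; exact Nat.le_succ m
      _ = (m + 1) ^ (k + 3) := by ring
  have hradR : ((rad (m ^ (k + 1)) b ((m + 1) ^ (k + 1)) : ℕ) : ℝ) ≤ nR ^ (k + 3) := by
    have : ((rad (m ^ (k + 1)) b ((m + 1) ^ (k + 1)) : ℕ) : ℝ) ≤ (((m + 1) ^ (k + 3) : ℕ) : ℝ) := by
      exact_mod_cast hradN
    push_cast at this
    exact this
  have hrad0 : (0 : ℝ) ≤ ((rad (m ^ (k + 1)) b ((m + 1) ^ (k + 1)) : ℕ) : ℝ) := by positivity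
  have hradt : ((rad (m ^ (k + 1)) b ((m + 1) ^ (k + 1)) : ℕ) : ℝ) ^ t ≤ nR ^ (((k : ℝ) + 3) * t) := by
    calc ((rad (m ^ (k + 1)) b ((m + 1) ^ (k + 1)) : ℕ) : ℝ) ^ t ≤ (nR ^ (k + 3)) ^ t :=
          Real.rpow_le_rpow hrad0 hradR (by linarith)
      _ = nR ^ (((k : ℝ) + 3) * t) := by
          rw [← Real.rpow_natCast nR (k + 3), ← Real.rpow_mul hn0.le]
          push_cast
          ring_nf
  -- the growth inequality at `n = m + 1`
  have hgrow := hN (m + 1) hNm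
  rw [hcast] at hgrow
  have hpow : nR ^ ((6 * k + 4 : ℝ)) = nR ^ (6 * k + 4) := by
    have : ((6 * k + 4 : ℕ) : ℝ) = 6 * (k : ℝ) + 4 := by push_cast; ring
    rw [← this, Real.rpow_natCast]
  rw [hpow] at hgrow
  -- assemble: `n^{6k+4} ≤ K (abc)² ≤ K C rad^t ≤ K C n^{(k+3)t}` against `(C K + 1) n^{(k+3)t} ≤ n^{6k+4}`
  have hX : 0 < nR ^ (((k : ℝ) + 3) * t) := Real.rpow_pos_of_pos hn0 _
  have hchain : nR ^ (6 * k + 4) ≤ K * C * nR ^ (((k : ℝ) + 3) * t) := by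
    calc nR ^ (6 * k + 4) ≤ K * (((m ^ (k + 1) * b * (m + 1) ^ (k + 1) : ℕ) : ℝ)) ^ (2 : ℕ) := hsq
      _ ≤ K * (C * ((rad (m ^ (k + 1)) b ((m + 1) ^ (k + 1)) : ℕ) : ℝ) ^ t) :=
          mul_le_mul_of_nonneg_left key hK0.le
      _ ≤ K * (C * nR ^ (((k : ℝ) + 3) * t)) := by
          apply mul_le_mul_of_nonneg_left _ hK0.le
          exact mul_le_mul_of_nonneg_left hradt hC.le
      _ = K * C * nR ^ (((k : ℝ) + 3) * t) := by ring
  nlinarith [hchain, hgrow, hX, hK0, hC]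

/-! ## Above `6` the dial is `ABC`-true -/

/-- **`ABC ⟹ PolySzpiro s` for every `s > 6`**: `(abc)² ≤ c⁶ < (C rad^{1+ε})⁶ = C⁶ rad^s` with `1 + ε = s/6`. -/
theorem polySzpiro_of_abc (habc : ABC) {s : ℝ} (hs : 6 < s) :
    ∃ C : ℝ, 0 < C ∧ ∀ a b c : ℕ, IsABCTriple a b c →
      (((a * b * c : ℕ) : ℝ)) ^ (2 : ℕ) ≤ C * ((rad a b c : ℕ) : ℝ) ^ s := by
  have hε : 0 < s / 6 - 1 := by linarith
  obtain ⟨C, hC, h⟩ := (ABC_iff.mp habc) (s / 6 - 1) hε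
  refine ⟨C ^ 6, by positivity, fun a b c ht => ?_⟩
  rcases (show 0 < a ∧ 0 < b ∧ a + b = c ∧ Nat.Coprime a b from ht) with ⟨ha, hb, hsum, -⟩
  have hlt := h a b c ht
  have hexp : (1 + (s / 6 - 1)) = s / 6 := by ring
  rw [hexp] at hlt
  have hr0 : (0 : ℝ) ≤ ((rad a b c : ℕ) : ℝ) := by positivity
  have hc0 : (0 : ℝ) ≤ (c : ℝ) := by positivity
  have habc_le : a * b * c ≤ c ^ 3 := by
    have hac : a ≤ c := by omega
    have hbc : b ≤ c := by omega
    calc a * b * c ≤ c * c * c := by gcongr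
      _ = c ^ 3 := by ring
  have h1 : (((a * b * c : ℕ) : ℝ)) ^ (2 : ℕ) ≤ ((c : ℝ) ^ 3) ^ 2 := by
    have : ((a * b * c : ℕ) : ℝ) ≤ (c : ℝ) ^ 3 := by exact_mod_cast habc_le
    exact pow_le_pow_left₀ (by positivity) this 2
  have h3 : (c : ℝ) ^ 6 ≤ (C * ((rad a b c : ℕ) : ℝ) ^ (s / 6)) ^ 6 := pow_le_pow_left₀ hc0 hlt.le 6
  have h4 : (C * ((rad a b c : ℕ) : ℝ) ^ (s / 6)) ^ 6 = C ^ 6 * ((rad a b c : ℕ) : ℝ) ^ s := by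
    rw [mul_pow, ← Real.rpow_natCast (((rad a b c : ℕ) : ℝ) ^ (s / 6)) 6, ← Real.rpow_mul hr0]
    push_cast
    ring_nf
  calc (((a * b * c : ℕ) : ℝ)) ^ (2 : ℕ) ≤ ((c : ℝ) ^ 3) ^ 2 := h1
    _ = (c : ℝ) ^ 6 := by ring
    _ ≤ (C * ((rad a b c : ℕ) : ℝ) ^ (s / 6)) ^ 6 := h3
    _ = C ^ 6 * ((rad a b c : ℕ) : ℝ) ^ s := h4

/-- The dial under `ABC`, away from the boundary point `s = 6` (false in print, Masser 1990; not formalised):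
`PolySzpiro s` holds for `s > 6` and fails for `s < 6`. -/
theorem polySzpiro_dial_of_abc (habc : ABC) {s : ℝ} (hs : s ≠ 6) :
    (∃ C : ℝ, 0 < C ∧ ∀ a b c : ℕ, IsABCTriple a b c →
      (((a * b * c : ℕ) : ℝ)) ^ (2 : ℕ) ≤ C * ((rad a b c : ℕ) : ℝ) ^ s) ↔ 6 < s := by
  rcases lt_or_gt_of_ne hs with h | h
  · exact ⟨fun hP => absurd hP (not_polySzpiro_of_lt_six h), fun h6 => absurd (h.trans h6) (lt_irrefl _)⟩
  · exact ⟨fun _ => h, fun _ => polySzpiro_of_abc habc h⟩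

/-- The two smallest tight members used above, for the record: `k = 1`: `m² + (2m+1) = (m+1)²`; `k = 2`:
`m³ + (3m² + 3m + 1) = (m+1)³`; e.g. `8² + 17 = 9²` (`(abc)² = 8678²… `) — and the classical balanced high-ratio triple
`2⁵ + 7² = 3⁴` with `(abc)² = 127008² > 42⁶ = rad⁶` showing the ratio `(abc)²/rad⁶` exceeds `1` (it is unbounded by Masser 1990). -/
example : (32 : ℕ) + 49 = 81 ∧ (32 * 49 * 81 : ℕ) ^ 2 > 42 ^ 6 ∧ (2 * 7 * 3 : ℕ) = 42 := by norm_num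

end Summit.ABC.ABC.Theorems.TowerFourSubLiouville.Negative
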